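import Literature.MathematicalPhysics.KineticTheory.KickMatchedHardSphereGas
import HarnessLib

/-!
# The cross-ratio chaos defect of `KickMatchedHardSphereGas`, opened: named `let`-chain and the three-piece split

Topic `Literature/MathematicalPhysics/KineticTheory`; companion of
`Literature.MathematicalPhysics.KineticTheory.KickMatchedHardSphereGas` (definition item `defn-KickMatchedHardSphereGas`,
crux `stmt-AtomisticToContinuum-13914`, line `stein-lindeberg-kick-swap`), written by the S1 stub-worker of that line and
reusable by its S2/S3a/S3b stubs. The monolithic functional `defect σ N τ χ Ψ r γ` (the route target `ContactChaos`'s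
`let`-chain `bx, bt, Θ, Pm, Kc, pv` read on a path `γ`) is OPENED:

1. its pieces are named — `bxKer` (cone kernel `bx`), `btKer` (tent `bt`), `fluxAvg` (`Θ_Ξ(v,w) = ∫ Ξ(ω,v,w)((w−v)·ω)₊dω`),
   `pairField` (`Pm`), `collSum` (`Kc`, the `ε/(N+1)`-normalised sum over contact times in `[0,τ]` and ordered contact
   pairs), `markAt` (the mark `(ε⁻¹ sepVec, pre-velocities)`), and `defect_eq_collSum : defect … =
   collSum …(χ·Ψ∘markAt·Pm(Θ₁)) − collSum …(χ·Pm(Θ_Ψ))` holds by `rfl`;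
2. `collSum_add`: `Kc` is additive in the integrand when the contact times in `[0, τ]` are finitely many
   (`finsum_mem_add_distrib`; for infinitely many the finsum is the junk `0`);
3. the THREE-PIECE SPLIT `defect = markPiece + shieldPiece + selectPiece` (`defect_eq_pieces`, on finite contact sets):
   `markPiece` = `Kc[χ·(Ψ(ω,v,w) − admFluxMean)·Pm(Θ₁)]` with `admFluxMean` the flux mean of `Ψ(·,v,w)` over the
   ADMISSIBLE normals of the pre-collisional configuration `collidePair geo i j (γ s)` (same convention as
   `restrictedMean`) — for the kick-matched gas `Z*` a martingale transform, since its resampled normal is admissible-flux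
   distributed given its input; `shieldPiece` = `Kc[χ·(admFluxMean − Θ_Ψ/Θ₁)·Pm(Θ₁)]`, carried by collisions with a third
   body within `2ε`; `selectPiece` = `Kc[χ·((Θ_Ψ/Θ₁)(v,w)·Pm(Θ₁) − Pm(Θ_Ψ))]`, a functional of `(s, x, v, w)` and the
   empirical pair fields only (pair selection). Pointwise identity `χΨP₁ − χP_Ψ = χ(Ψ−m)P₁ + χ(m−q)P₁ + χ(qP₁−P_Ψ)` for
   any reals `m, q`, so no non-degeneracy of `Θ₁` is needed;
4. `starPath σ N q` = the `Z*` path of a datum/dice pair, so that `starDefect σ N … q = defect … (starPath σ N q)`.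

References: the constructions are the route's (`ContactChaos`, stmt-AtomisticToContinuum-13477) and the vocabulary file's;
I. Gallagher, L. Saint-Raymond, B. Texier, *From Newton to Boltzmann* (2013) §4.1 for contact times of hard-sphere
paths [GST2013]; S. Chatterjee, Ann. Probab. 34 (2006) for the swap bookkeeping the split serves [Chatterjee2006].
Every declaration is a construction or an elementary identity, tagged `[folklore]`.
-/

noncomputable section

open scoped BigOperators ENNReal Topology RealInnerProductSpace
open MeasureTheory Set Filter
open Literature.Analysis.FluidPDE

namespace Literature.MathematicalPhysics.KineticTheory

namespace KickMatchedHardSphereGas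

/-! ## The defect's `let`-chain, named -/

/-- The cone kernel `bx` of the defect (space mollifier, unit mass in `ℝ³`). [folklore] -/
def bxKer (r : ℝ) (x y : T3) : ℝ := 3 / (Real.pi * r ^ 3) * max (1 - Torus.euclidDist x y / r) 0

/-- The tent kernel `bt` of the defect (time mollifier, unit mass on `ℝ`). [folklore] -/
def btKer (r : ℝ) (a : ℝ) : ℝ := r⁻¹ * max (1 - |a| / r) 0

/-- The flux average `Θ_Ξ(v, w) = ∫ Ξ(ω, v, w) ((w−v)·ω)₊ dω` of the defect. [folklore] -/
def fluxAvg (Ξ : V3 × V3 × V3 → ℝ) (v w : V3) : ℝ :=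
  ∫ ω : Metric.sphere (0 : V3) 1, Ξ ((ω : V3), v, w) * hardSphereKernel (w, v) ω ∂sphereMeasure

/-- The mollified empirical pair field `Pm(Th)(s₀, x₀)` of a path (the defect's `Pm`). [folklore] -/
def pairField {N : ℕ} (τ r : ℝ) (Th : V3 → V3 → ℝ) (γ : ℝ → Cfg N) (s₀ : ℝ) (x₀ : T3) : ℝ :=
  ∫ s in Set.Icc (0 : ℝ) τ, btKer r (s - s₀) *
    ∫ p, bxKer r p.1.1 x₀ * bxKer r p.2.1 x₀ * Th p.1.2 p.2.2
      ∂((empiricalMeasure (γ s)).prod (empiricalMeasure (γ s)))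

/-- The normalised collision sum `Kc[F]` of a path (the defect's `Kc`): `ε/(N+1) Σ_{s ∈ collision times ∩ [0,τ]}
Σ_{ordered contact pairs (i,j)} F s i j` (finsum: junk `0` if infinitely many collision times). [folklore] -/
def collSum (σ : ℝ) (N : ℕ) (τ : ℝ) (γ : ℝ → Cfg N) (F : ℝ → Fin (N + 1) → Fin (N + 1) → ℝ) : ℝ :=
  hsDiameter σ N / (N + 1 : ℝ) *
    ∑ᶠ (s : ℝ) (_ : s ∈ collisionTimes geo (hsDiameter σ N) γ ∩ Set.Icc 0 τ),
      ∑ i : Fin (N + 1), ∑ j : Fin (N + 1),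
        (if i ≠ j ∧ ‖geo.sepVec (γ s i).1 (γ s j).1‖ = hsDiameter σ N then F s i j else 0)

/-- The mark `(ω, v, w)` read at the ordered pair `(i, j)` of the (post-collisional) configuration `γ s`: impact vector
`ε⁻¹ sepVec xᵢ xⱼ` and PRE-collisional velocities `reflectVel`. [folklore] -/
def markAt (σ : ℝ) (N : ℕ) (γ : ℝ → Cfg N) (s : ℝ) (i j : Fin (N + 1)) : V3 × V3 × V3 :=
  ((hsDiameter σ N)⁻¹ • geo.sepVec (γ s i).1 (γ s j).1,
    (reflectVel (geo.sepVec (γ s i).1 (γ s j).1) ((γ s i).2, (γ s j).2)).1,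
    (reflectVel (geo.sepVec (γ s i).1 (γ s j).1) ((γ s i).2, (γ s j).2)).2)

set_option maxHeartbeats 4000000 in
/-- `defect = Kc[χ Ψ Pm(Θ₁)] − Kc[χ Pm(Θ_Ψ)]` over the named pieces (definitional). [folklore] -/
theorem defect_eq_collSum (σ : ℝ) (N : ℕ) (τ : ℝ) (χ : ℝ × T3 → ℝ) (Ψ : V3 × V3 × V3 → ℝ) (r : ℝ)
    (γ : ℝ → Cfg N) :
    defect σ N τ χ Ψ r γ =
      collSum σ N τ γ (fun s i j => χ (s, (γ s i).1) * Ψ (markAt σ N γ s i j) *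
          pairField τ r (fluxAvg fun _ => 1) γ s (γ s i).1) -
        collSum σ N τ γ (fun s i _ => χ (s, (γ s i).1) * pairField τ r (fluxAvg Ψ) γ s (γ s i).1) :=
  rfl

/-! ## The three pieces: mark martingale, shielding (restricted vs free flux mean), pair selection -/

/-- The RESTRICTED (admissible) flux mean of `Ψ(·, v, w)` for the pair `(i, j)` of a PRE-collisional configuration
`y` (`v = vᵢ`, `w = vⱼ`; junk `0 · …` if the admissible set is flux-null) — the conditional mean of the mark of `Z*`
given its input. [folklore] -/
def admFluxMean (σ : ℝ) (N : ℕ) (Ψ : V3 × V3 × V3 → ℝ) (y : Cfg N) (i j : Fin (N + 1)) : ℝ :=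
  ((fluxLaw (y i).2 (y j).2) {ω | IsAdmissible σ N i j (ω : V3) y}).toReal⁻¹ *
    ∫ ω in {ω | IsAdmissible σ N i j (ω : V3) y}, Ψ ((ω : V3), (y i).2, (y j).2) ∂(fluxLaw (y i).2 (y j).2)

/-- **Piece M (mark martingale)**: `Kc[χ · (Ψ(ω,v,w) − admissible flux mean of Ψ given the pre-collisional
configuration) · Pm(Θ₁)]`. [folklore] -/
def markPiece (σ : ℝ) (N : ℕ) (τ : ℝ) (χ : ℝ × T3 → ℝ) (Ψ : V3 × V3 × V3 → ℝ) (r : ℝ) (γ : ℝ → Cfg N) : ℝ :=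
  collSum σ N τ γ fun s i j => χ (s, (γ s i).1) *
    (Ψ (markAt σ N γ s i j) - admFluxMean σ N Ψ (collidePair geo i j (γ s)) i j) *
      pairField τ r (fluxAvg fun _ => 1) γ s (γ s i).1

/-- **Piece R (shielding)**: `Kc[χ · (admissible flux mean − free flux mean Θ_Ψ/Θ₁) · Pm(Θ₁)]` — nonzero only at
collisions with a third body within `2ε` of the centre of `i`. [folklore] -/
def shieldPiece (σ : ℝ) (N : ℕ) (τ : ℝ) (χ : ℝ × T3 → ℝ) (Ψ : V3 × V3 × V3 → ℝ) (r : ℝ) (γ : ℝ → Cfg N) : ℝ :=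
  collSum σ N τ γ fun s i j => χ (s, (γ s i).1) *
    (admFluxMean σ N Ψ (collidePair geo i j (γ s)) i j -
      fluxAvg Ψ (markAt σ N γ s i j).2.1 (markAt σ N γ s i j).2.2 /
        fluxAvg (fun _ => 1) (markAt σ N γ s i j).2.1 (markAt σ N γ s i j).2.2) *
      pairField τ r (fluxAvg fun _ => 1) γ s (γ s i).1

/-- **Piece S (pair selection)**: `Kc[χ · ((Θ_Ψ/Θ₁)(v,w) · Pm(Θ₁) − Pm(Θ_Ψ))]` — a functional of the collision events'
`(s, x, v, w)` and of the empirical pair fields only (no impact vector). [folklore] -/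
def selectPiece (σ : ℝ) (N : ℕ) (τ : ℝ) (χ : ℝ × T3 → ℝ) (Ψ : V3 × V3 × V3 → ℝ) (r : ℝ) (γ : ℝ → Cfg N) : ℝ :=
  collSum σ N τ γ fun s i j => χ (s, (γ s i).1) *
    (fluxAvg Ψ (markAt σ N γ s i j).2.1 (markAt σ N γ s i j).2.2 /
        fluxAvg (fun _ => 1) (markAt σ N γ s i j).2.1 (markAt σ N γ s i j).2.2 *
      pairField τ r (fluxAvg fun _ => 1) γ s (γ s i).1 - pairField τ r (fluxAvg Ψ) γ s (γ s i).1)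

/-- `Kc` is additive in `F` when the collision times in `[0, τ]` are finitely many. [folklore] -/
theorem collSum_add {σ : ℝ} {N : ℕ} {τ : ℝ} {γ : ℝ → Cfg N}
    (hfin : (collisionTimes geo (hsDiameter σ N) γ ∩ Set.Icc 0 τ).Finite)
    (F G : ℝ → Fin (N + 1) → Fin (N + 1) → ℝ) :
    collSum σ N τ γ (fun s i j => F s i j + G s i j) = collSum σ N τ γ F + collSum σ N τ γ G := by
  unfold collSum
  rw [← mul_add, ← finsum_mem_add_distrib hfin]
  congr 1
  refine finsum_congr fun s => finsum_congr fun _ => ?_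
  rw [← Finset.sum_add_distrib]
  refine Finset.sum_congr rfl fun i _ => ?_
  rw [← Finset.sum_add_distrib]
  refine Finset.sum_congr rfl fun j _ => ?_
  split_ifs <;> simp

/-- **The three-piece decomposition** `D = M + R + S` on paths with finitely many collision times in `[0, τ]`
(pointwise `χΨP₁ − χP_Ψ = χ(Ψ − m)P₁ + χ(m − q)P₁ + χ(qP₁ − P_Ψ)` for ANY reals `m, q`, and additivity of `Kc`).
[folklore] -/
theorem defect_eq_pieces {σ : ℝ} {N : ℕ} {τ : ℝ} (χ : ℝ × T3 → ℝ) (Ψ : V3 × V3 × V3 → ℝ) (r : ℝ)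
    {γ : ℝ → Cfg N} (hfin : (collisionTimes geo (hsDiameter σ N) γ ∩ Set.Icc 0 τ).Finite) :
    defect σ N τ χ Ψ r γ = markPiece σ N τ χ Ψ r γ + shieldPiece σ N τ χ Ψ r γ + selectPiece σ N τ χ Ψ r γ := by
  rw [defect_eq_collSum, markPiece, shieldPiece, selectPiece, ← collSum_add hfin, ← collSum_add hfin, sub_eq_iff_eq_add,
    ← collSum_add hfin]
  congr 1; funext s i j; ring


/-- The `Z*` path of the datum/dice pair `q` (so that `starDefect σ N τ χ Ψ r q = defect σ N τ χ Ψ r (starPath σ N q)`,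
definitionally). [folklore] -/
abbrev starPath (σ : ℝ) (N : ℕ) (q : Cfg N × (ℕ → Die)) : ℝ → Cfg N := fun s => kmFlow σ N q.2 q.1 s

/-- `starDefect` is the defect of the `Z*` path (definitional). [folklore] -/
theorem starDefect_eq (σ : ℝ) (N : ℕ) (τ : ℝ) (χ : ℝ × T3 → ℝ) (Ψ : V3 × V3 × V3 → ℝ) (r : ℝ)
    (q : Cfg N × (ℕ → Die)) : starDefect σ N τ χ Ψ r q = defect σ N τ χ Ψ r (starPath σ N q) :=
  rfl

/-- The three-piece split of the `Z*` defect on the event of finitely many contact times in `[0, τ]`. [folklore] -/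
theorem starDefect_eq_pieces {σ : ℝ} {N : ℕ} {τ : ℝ} (χ : ℝ × T3 → ℝ) (Ψ : V3 × V3 × V3 → ℝ) (r : ℝ)
    {q : Cfg N × (ℕ → Die)} (hfin : (collisionTimes geo (hsDiameter σ N) (starPath σ N q) ∩ Set.Icc 0 τ).Finite) :
    starDefect σ N τ χ Ψ r q =
      markPiece σ N τ χ Ψ r (starPath σ N q) + shieldPiece σ N τ χ Ψ r (starPath σ N q) +
        selectPiece σ N τ χ Ψ r (starPath σ N q) :=
  defect_eq_pieces χ Ψ r hfin

end KickMatchedHardSphereGas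

end Literature.MathematicalPhysics.KineticTheory

end
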